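import Summits.BirchSwinnertonDyer.BirchSwinnertonDyer.Theorems.SylvesterTwoHeegnerIndexYinDivisibilityIndex
import Summits.BirchSwinnertonDyer.BirchSwinnertonDyer.Theorems.SylvesterTwoHeegnerIndexLowerSplit
import HarnessLib

/-!
# Route `SylvesterTwoHeegnerIndex` (rung K7t), LOWER cruxes 19891 `LowerOnV0HSY` / 19892 `LowerOffV0HSY`:
# the REGISTERED pair-currency stubs ⟺ POINT-DIVISIBILITY of Hu–Shu–Yin's Heegner point — PRINT-ONLY
# re-typing (no preprint input), both directions

Cell `bsd-cm`, seat `bsd-cm-k7t-c2` (prover-bsd-cm-k7t-c2-g9-0). PARTITION (D-0054): CornerF at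
`p = 2` (B14/O12) × 𝒞_HSY (both residue classes) × `p = 2` — types-the-object-of (kernel re-typing,
`--supports stmt-BirchSwinnertonDyer-19892`); closes no cell and no item; BSD is not claimed.
Everything here is PROVED: no definition, no named fact, no `sorry`.

WHY THIS FILE AFTER `…YinLower`. Parts I–III re-typed the LOWER half in YIN's single-curve currency,
whose display is a 2026 PREPRINT. Hu–Shu–Yin's PAIR display `shaAnPair_mul_height_eq_two_zpow_mul_height`
(Trans. AMS 2019, (bsd) p. 12 + Cor. 4.4 — a PUBLISHED named fact of the tree, conjunct of the route's
`PublishedFactsTwoPlus`, item 19726) has the SAME engine shape: `(#Ш_an(B)·#Ш_an(A))·ĥ_K(ι P) = 2^i·ĥ_K(Y)`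
with `Y ∈ B(K)` Hu–Shu–Yin's point `R − T`, `i = 0 | −2`. So the skeletons of record (planner g21:
`stub_pairBoundOffV0_{four,seven}ModNine`, `stub_pairLeZeroOnV0_{four,seven}ModNine`, PAIR currency
`ord₂(qB·qA) ≤ s_B + s_A` / `≤ 0`) admit a point-divisibility form GRANTED PRINT ONLY:

* §1 (datum, pure engine) `padicValRat_le_iff_forall_powDivisible` /
  `le_padicValRat_iff_exists_powDivisible`: for a display datum `q·ĥ_K(ι P₀) = 2^i·ĥ_K(Y)` (`q ≠ 0`,
  `i` even) and ANY integer bound `b`: `ord₂ q ≤ b ⟺ (∀ j, Y ∈ 2^j·B(K) + tors → i + 2j ≤ b)` and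
  `b ≤ ord₂ q ⟺ (∃ j, Y ∈ 2^j·B(K) + tors ∧ b ≤ i + 2j)` (from `…YinDivisibilityIndex` §1).
* §2 (class, granted the PRINTED display `hH`): **`pairBoundOffV0_iff_pointBoundOffV0`** — the off-`𝒱₀`
  stub statement (both residue classes at once; restrict `p % 9` for the registered halves) ⟺ (lowP-off)
  «granted `PublishedFactsTwo`, at every HSY display datum `(K ∋ ω, P₀, Y)` of every off-`𝒱₀` pair with
  `#Ш_an(B) = qB`, `#Ш_an(A) = qA`: `Y ∈ 2^j·B(K) + tors ⟹ i + 2j ≤ s_B + s_A`»; and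
  **`pairLeZeroOnV0_iff_pointBoundOnV0`** — the `𝒱₀` stub statement ⟺ (lowP-on) «… on `𝒱₀`:
  `Y ∈ 2^j·B(K) + tors ⟹ i + 2j ≤ 0`», i.e. Hu–Shu–Yin's point is `2`-PRIMITIVE (`p ≡ 4 (9)`) / NOT in
  `4·E_p(K) + tors` (`p ≡ 7 (9)`) wherever both `2`-primary Ш's are trivial.
* §3 the LIVE cruxes BY NAME: `lowerOffV0HSY_iff_pointBoundOffV0`, `lowerOnV0HSY_iff_pointBoundOnV0`
  (through k7t-c3's `SylvesterTwoLowerSplit.lowerOffV0_iff_pairBound` / `lowerOnV0_iff_pairLeZero`,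
  p471972); a point-currency skeleton composes with their `.mpr` (stubs: the printed display as a
  displayed named fact + (lowP-off) / (lowP-on), restricted to a residue class if wanted).

HONEST READING. A lossless change of currency, granted one PRINTED display; the residuals (lowP-off) /
(lowP-on) are the main-conjecture direction at the inert prime `2` («extra `2`-divisibility of the
explicit Heegner point FORCES Ш»), OPEN as a class (memo two §22.3), certified per member on the k7t-c3
census. Compared with parts I–III: no preprint, but the twin `A ≅ E_{3p²}` stays in the binders.

## References
* Y. Hu, J. Shu, H. Yin, Trans. AMS 372 (2019) = arXiv:1708.05266, Thm. 1.3/1.4, Cor. 4.4, (bsd) p. 12, p. 8.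
* A. Burungale, M. Flach, Camb. J. Math. 12 (2024), Thm. 1.1, Cor. 2; R. L. Miller, LMS J. Comput. Math. 14
  (2011), Def. 1.1.
* MEMO bsd-cm-two v2.11 §15.2 Thm B, §22; parents p471972 (`…LowerSplit`), this seat's p511845.
-/

set_option autoImplicit false
-- the Summit-side namespace `Summit.BirchSwinnertonDyer.BirchSwinnertonDyer.…` (summit = problem) is mandated by D-0017
set_option linter.dupNamespace false

noncomputable section

open scoped Classical

open WeierstrassCurve WeierstrassCurve.Affine WeierstrassCurve.Affine.Point
  Summit.BirchSwinnertonDyer.BirchSwinnertonDyer.Theorems.SylvesterTwoCMNormForm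
  Summit.BirchSwinnertonDyer.BirchSwinnertonDyer.Theorems.SylvesterTwoNonneg
  Summit.BirchSwinnertonDyer.BirchSwinnertonDyer.Theorems.SylvesterTwoThmCAssembly
  Literature.NumberTheory.EllipticCurves Literature.NumberTheory.EllipticCurves.HuShuYin2019
  Literature.NumberTheory.EllipticCurves.Rank1Residual.Typed

namespace Summit.BirchSwinnertonDyer.BirchSwinnertonDyer.Theorems.SylvesterTwoYinLower

/-! ## §1 Datum level: a `2`-adic bound on `q` IS a bound on the divisibility index of `Y` -/

section Datum

variable {K : Type} [Field K] [NumberField K] {ω : K}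

/-- **`ord₂ q ≤ b ⟺ every `2^j ∣ Y` has `i + 2j ≤ b`**, for ANY integer `b`, at an engine datum
(`K ∋ ω` quadratic, `B` a model of `E_p`, `p` odd prime, `rank_ℤ B(K) = 2`, rational generator `P₀`,
`Y ∈ B(K)`, `q ≠ 0`, `i` even, `q·ĥ_K(ι P₀) = 2^i·ĥ_K(Y)`): because `ord₂ q = i + 2·(index of Y)`
(`exists_divisibilityIndex_of_model`). [cite: HuShuYin2019, pp. 8, 12] -/
theorem padicValRat_le_iff_forall_powDivisible (hω : ω ^ 2 + ω + 1 = 0)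
    (h2K : Module.finrank ℚ K = 2) {p : ℕ} (hp : p.Prime) (hp2 : p ≠ 2) (B : WeierstrassCurve ℚ)
    [B.IsElliptic] (C : VariableChange ℚ) (hC : C • B = cubeSumCurve (p : ℚ))
    (hrank : (B.baseChange K).mordellWeilRank = 2) (P₀ : B.toAffine.Point)
    (hP : ¬ IsOfFinAddOrder (QuadraticDescent.incl K B P₀))
    (hgen : ∀ Q : B.toAffine.Point, ∃ m : ℤ,
      IsOfFinAddOrder (QuadraticDescent.incl K B Q - m • QuadraticDescent.incl K B P₀))
    (Y : (B.baseChange K).toAffine.Point) {q : ℚ} (hq : q ≠ 0) {i : ℤ} (hi : Even i)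
    (hid : (q : ℝ) * canonicalHeight (QuadraticDescent.incl K B P₀) = (2 : ℝ) ^ i * canonicalHeight Y)
    (b : ℤ) :
    padicValRat 2 q ≤ b ↔
      ∀ j : ℕ, (∃ Y' T' : (B.baseChange K).toAffine.Point,
          IsOfFinAddOrder T' ∧ Y = ((2 : ℤ) ^ j) • Y' + T') → i + 2 * (j : ℤ) ≤ b := by
  constructor
  · intro hle j hdiv
    exact le_trans (le_padicValRat_two_of_model_of_powDivisible hω h2K hp hp2 B C hC hrank P₀ hP hgen
      hq hid hdiv) hle
  · intro h
    obtain ⟨j, hj, hdiv, -⟩ := exists_divisibilityIndex_of_model hω h2K hp hp2 B C hC hrank P₀ hP hgen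
      Y hq hi hid
    rw [hj]
    exact h j hdiv

/-- **`b ≤ ord₂ q ⟺ some `2^j ∣ Y` has `b ≤ i + 2j`** (same datum, any integer `b`) — the UPPER-side
form. [cite: HuShuYin2019, pp. 8, 12] -/
theorem le_padicValRat_iff_exists_powDivisible (hω : ω ^ 2 + ω + 1 = 0)
    (h2K : Module.finrank ℚ K = 2) {p : ℕ} (hp : p.Prime) (hp2 : p ≠ 2) (B : WeierstrassCurve ℚ)
    [B.IsElliptic] (C : VariableChange ℚ) (hC : C • B = cubeSumCurve (p : ℚ))
    (hrank : (B.baseChange K).mordellWeilRank = 2) (P₀ : B.toAffine.Point)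
    (hP : ¬ IsOfFinAddOrder (QuadraticDescent.incl K B P₀))
    (hgen : ∀ Q : B.toAffine.Point, ∃ m : ℤ,
      IsOfFinAddOrder (QuadraticDescent.incl K B Q - m • QuadraticDescent.incl K B P₀))
    (Y : (B.baseChange K).toAffine.Point) {q : ℚ} (hq : q ≠ 0) {i : ℤ} (hi : Even i)
    (hid : (q : ℝ) * canonicalHeight (QuadraticDescent.incl K B P₀) = (2 : ℝ) ^ i * canonicalHeight Y)
    (b : ℤ) :
    b ≤ padicValRat 2 q ↔
      ∃ j : ℕ, (∃ Y' T' : (B.baseChange K).toAffine.Point,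
          IsOfFinAddOrder T' ∧ Y = ((2 : ℤ) ^ j) • Y' + T') ∧ b ≤ i + 2 * (j : ℤ) := by
  constructor
  · intro hle
    obtain ⟨j, hj, hdiv, -⟩ := exists_divisibilityIndex_of_model hω h2K hp hp2 B C hC hrank P₀ hP hgen
      Y hq hi hid
    exact ⟨j, hdiv, by rw [← hj]; exact hle⟩
  · rintro ⟨j, hdiv, hle⟩
    exact le_trans hle (le_padicValRat_two_of_model_of_powDivisible hω h2K hp hp2 B C hC hrank P₀ hP
      hgen hq hid hdiv)

end Datum

/-! ## §2 Class level, granted Hu–Shu–Yin's PRINTED display: the registered stub statements ⟺ point bounds -/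

/-- **OFF `𝒱₀`: the pair bound IS «Hu–Shu–Yin's point is not too `2`-divisible».** Granted the printed
display `hH` (HSY (bsd) p. 12 + Cor. 4.4; tree named fact, item 19726): the off-`𝒱₀` stub statement of
19892 (both residue classes; PAIR currency `ord₂(#Ш_an(B)·#Ш_an(A)) ≤ ord₂ #Ш(B)[2^∞] + ord₂ #Ш(A)[2^∞]`)
holds IFF (lowP-off): at every display datum `(K ∋ ω, P₀, Y)` of every off-`𝒱₀` pair, every power `2^j`
dividing `Y` modulo torsion has `i + 2j ≤ s_B + s_A` (`i = 0 | −2` for `p ≡ 4 | 7 (9)`). `→`: the le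
direction of the engine; `←`: at `K = ℚ(ζ₃)` the display supplies the datum and §1 applies. Neither side
is asserted; both OPEN as a class. [cite: HuShuYin2019, display (bsd) p. 12 with Cor. 4.4, p. 8]
[cite: Miller2011LMS, Def. 1.1] -/
theorem pairBoundOffV0_iff_pointBoundOffV0 (hH : shaAnPair_mul_height_eq_two_zpow_mul_height) :
    (Theses.SylvesterTwoHeegnerIndex.PublishedFactsTwo → ∀ (p : ℕ), p.Prime → (p % 9 = 4 ∨ p % 9 = 7) →
        (¬ ∃ x : ZMod p, x ^ 3 = 3) →
        ∀ (A B : WeierstrassCurve ℚ) [A.IsElliptic] [A.IsGloballyMinimal] [B.IsElliptic]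
          [B.IsGloballyMinimal], (∃ C : VariableChange ℚ, C • B = cubeSumCurve (p : ℚ)) →
          (∃ C : VariableChange ℚ, C • A = cubeSumCurve (3 * (p : ℚ) ^ 2)) →
          ¬ (Nat.card (AddCommGroup.primaryComponent B.sha 2) = 1 ∧
            Nat.card (AddCommGroup.primaryComponent A.sha 2) = 1) →
          ∃ qB qA : ℚ, shaAn B = (qB : ℂ) ∧ shaAn A = (qA : ℂ) ∧ qB * qA ≠ 0 ∧
            padicValRat 2 (qB * qA) ≤
              (padicValNat 2 (Nat.card (AddCommGroup.primaryComponent B.sha 2)) : ℤ) +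
                (padicValNat 2 (Nat.card (AddCommGroup.primaryComponent A.sha 2)) : ℤ)) ↔
      (Theses.SylvesterTwoHeegnerIndex.PublishedFactsTwo → ∀ (p : ℕ), p.Prime → (p % 9 = 4 ∨ p % 9 = 7) →
        (¬ ∃ x : ZMod p, x ^ 3 = 3) →
        ∀ (A B : WeierstrassCurve ℚ) [A.IsElliptic] [A.IsGloballyMinimal] [B.IsElliptic]
          [B.IsGloballyMinimal], (∃ C : VariableChange ℚ, C • B = cubeSumCurve (p : ℚ)) →
          (∃ C : VariableChange ℚ, C • A = cubeSumCurve (3 * (p : ℚ) ^ 2)) →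
          ¬ (Nat.card (AddCommGroup.primaryComponent B.sha 2) = 1 ∧
            Nat.card (AddCommGroup.primaryComponent A.sha 2) = 1) →
          ∀ (qB qA : ℚ), shaAn B = (qB : ℂ) → shaAn A = (qA : ℂ) →
          ∀ (K : Type) [Field K] [NumberField K] (ω : K), ω ^ 2 + ω + 1 = 0 → Module.finrank ℚ K = 2 →
          ∀ (P₀ : B.toAffine.Point), ¬ IsOfFinAddOrder (QuadraticDescent.incl K B P₀) →
            (∀ Q : B.toAffine.Point, ∃ m : ℤ,
              IsOfFinAddOrder (QuadraticDescent.incl K B Q - m • QuadraticDescent.incl K B P₀)) →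
          ∀ (Y : (B.baseChange K).toAffine.Point),
            ((qB * qA : ℚ) : ℝ) * canonicalHeight (QuadraticDescent.incl K B P₀) =
              (2 : ℝ) ^ (if p % 9 = 4 then (0 : ℤ) else -2) * canonicalHeight Y →
          ∀ j : ℕ, (∃ Y' T' : (B.baseChange K).toAffine.Point,
              IsOfFinAddOrder T' ∧ Y = ((2 : ℤ) ^ j) • Y' + T') →
            (if p % 9 = 4 then (0 : ℤ) else -2) + 2 * (j : ℤ) ≤
              (padicValNat 2 (Nat.card (AddCommGroup.primaryComponent B.sha 2)) : ℤ) +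
                (padicValNat 2 (Nat.card (AddCommGroup.primaryComponent A.sha 2)) : ℤ)) := by
  constructor
  · intro h hF p hp h9 h3 A B _ _ _ _ hB hA hV qB qA hqB hqA K _ _ ω hω h2K P₀ hP hgen Y hid j hdiv
    obtain ⟨qB', qA', hqB', hqA', hne, hle⟩ := h hF p hp h9 h3 A B hB hA hV
    have eB : qB' = qB := by exact_mod_cast hqB'.symm.trans hqB
    have eA : qA' = qA := by exact_mod_cast hqA'.symm.trans hqA
    subst eB eA
    obtain ⟨-, -, -, -, -, hrank, -⟩ := hH p hp h9 h3 A B hB hA K ω hω h2K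
    obtain ⟨C, hC⟩ := hB
    have hp2 : p ≠ 2 := SylvesterTwoLower.ne_two_of_mod_nine h9
    exact le_trans (le_padicValRat_two_of_model_of_powDivisible hω h2K hp hp2 B C hC hrank P₀ hP hgen
      hne hid hdiv) hle
  · intro h hF p hp h9 h3 A B _ _ _ _ hB hA hV
    obtain ⟨ω, hω⟩ := exists_omega_cyclotomicField_three
    have h2K := finrank_cyclotomicField_three
    obtain ⟨qB, qA, hqB, hqA, hne, hrank, P, Y, hP, hgen, hid⟩ :=
      hH p hp h9 h3 A B hB hA (CyclotomicField 3 ℚ) ω hω h2K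
    refine ⟨qB, qA, hqB, hqA, hne, ?_⟩
    have hB' := hB
    obtain ⟨C, hC⟩ := hB'
    have hp2 : p ≠ 2 := SylvesterTwoLower.ne_two_of_mod_nine h9
    exact (padicValRat_le_iff_forall_powDivisible hω h2K hp hp2 B C hC hrank P hP hgen Y hne
      (SylvesterTwoYin.even_displayExponent p) hid _).mpr
      (h hF p hp h9 h3 A B hB hA hV qB qA hqB hqA (CyclotomicField 3 ℚ) ω hω h2K P hP hgen Y hid)

/-- **ON `𝒱₀`: the pair product is a `2`-adic unit-or-better IFF Hu–Shu–Yin's point has index ≤ −i/2**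
— i.e. is `2`-PRIMITIVE for `p ≡ 4 (9)` and NOT in `4·E_p(K) + tors` for `p ≡ 7 (9)` (one factor `2`
being THEOREM C's). Granted the printed display `hH`: the `𝒱₀` stub statement of 19891 (both residue
classes; `ord₂(qB·qA) ≤ 0`) ⟺ (lowP-on). Neither side asserted; OPEN as a class (memo two N7/R78: «on
𝒰, m(p) = 0»). [cite: HuShuYin2019, display (bsd) p. 12 with Cor. 4.4, p. 8] [cite: Miller2011LMS, Def. 1.1] -/
theorem pairLeZeroOnV0_iff_pointBoundOnV0 (hH : shaAnPair_mul_height_eq_two_zpow_mul_height) :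
    (Theses.SylvesterTwoHeegnerIndex.PublishedFactsTwo → ∀ (p : ℕ), p.Prime → (p % 9 = 4 ∨ p % 9 = 7) →
        (¬ ∃ x : ZMod p, x ^ 3 = 3) →
        ∀ (A B : WeierstrassCurve ℚ) [A.IsElliptic] [A.IsGloballyMinimal] [B.IsElliptic]
          [B.IsGloballyMinimal], (∃ C : VariableChange ℚ, C • B = cubeSumCurve (p : ℚ)) →
          (∃ C : VariableChange ℚ, C • A = cubeSumCurve (3 * (p : ℚ) ^ 2)) →
          (Nat.card (AddCommGroup.primaryComponent B.sha 2) = 1 ∧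
            Nat.card (AddCommGroup.primaryComponent A.sha 2) = 1) →
          ∃ qB qA : ℚ, shaAn B = (qB : ℂ) ∧ shaAn A = (qA : ℂ) ∧ qB * qA ≠ 0 ∧
            padicValRat 2 (qB * qA) ≤ 0) ↔
      (Theses.SylvesterTwoHeegnerIndex.PublishedFactsTwo → ∀ (p : ℕ), p.Prime → (p % 9 = 4 ∨ p % 9 = 7) →
        (¬ ∃ x : ZMod p, x ^ 3 = 3) →
        ∀ (A B : WeierstrassCurve ℚ) [A.IsElliptic] [A.IsGloballyMinimal] [B.IsElliptic]
          [B.IsGloballyMinimal], (∃ C : VariableChange ℚ, C • B = cubeSumCurve (p : ℚ)) →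
          (∃ C : VariableChange ℚ, C • A = cubeSumCurve (3 * (p : ℚ) ^ 2)) →
          (Nat.card (AddCommGroup.primaryComponent B.sha 2) = 1 ∧
            Nat.card (AddCommGroup.primaryComponent A.sha 2) = 1) →
          ∀ (qB qA : ℚ), shaAn B = (qB : ℂ) → shaAn A = (qA : ℂ) →
          ∀ (K : Type) [Field K] [NumberField K] (ω : K), ω ^ 2 + ω + 1 = 0 → Module.finrank ℚ K = 2 →
          ∀ (P₀ : B.toAffine.Point), ¬ IsOfFinAddOrder (QuadraticDescent.incl K B P₀) →
            (∀ Q : B.toAffine.Point, ∃ m : ℤ,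
              IsOfFinAddOrder (QuadraticDescent.incl K B Q - m • QuadraticDescent.incl K B P₀)) →
          ∀ (Y : (B.baseChange K).toAffine.Point),
            ((qB * qA : ℚ) : ℝ) * canonicalHeight (QuadraticDescent.incl K B P₀) =
              (2 : ℝ) ^ (if p % 9 = 4 then (0 : ℤ) else -2) * canonicalHeight Y →
          ∀ j : ℕ, (∃ Y' T' : (B.baseChange K).toAffine.Point,
              IsOfFinAddOrder T' ∧ Y = ((2 : ℤ) ^ j) • Y' + T') →
            (if p % 9 = 4 then (0 : ℤ) else -2) + 2 * (j : ℤ) ≤ 0) := by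
  constructor
  · intro h hF p hp h9 h3 A B _ _ _ _ hB hA hV qB qA hqB hqA K _ _ ω hω h2K P₀ hP hgen Y hid j hdiv
    obtain ⟨qB', qA', hqB', hqA', hne, hle⟩ := h hF p hp h9 h3 A B hB hA hV
    have eB : qB' = qB := by exact_mod_cast hqB'.symm.trans hqB
    have eA : qA' = qA := by exact_mod_cast hqA'.symm.trans hqA
    subst eB eA
    obtain ⟨-, -, -, -, -, hrank, -⟩ := hH p hp h9 h3 A B hB hA K ω hω h2K
    obtain ⟨C, hC⟩ := hB
    have hp2 : p ≠ 2 := SylvesterTwoLower.ne_two_of_mod_nine h9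
    exact le_trans (le_padicValRat_two_of_model_of_powDivisible hω h2K hp hp2 B C hC hrank P₀ hP hgen
      hne hid hdiv) hle
  · intro h hF p hp h9 h3 A B _ _ _ _ hB hA hV
    obtain ⟨ω, hω⟩ := exists_omega_cyclotomicField_three
    have h2K := finrank_cyclotomicField_three
    obtain ⟨qB, qA, hqB, hqA, hne, hrank, P, Y, hP, hgen, hid⟩ :=
      hH p hp h9 h3 A B hB hA (CyclotomicField 3 ℚ) ω hω h2K
    refine ⟨qB, qA, hqB, hqA, hne, ?_⟩
    have hB' := hB
    obtain ⟨C, hC⟩ := hB'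
    have hp2 : p ≠ 2 := SylvesterTwoLower.ne_two_of_mod_nine h9
    exact (padicValRat_le_iff_forall_powDivisible hω h2K hp hp2 B C hC hrank P hP hgen Y hne
      (SylvesterTwoYin.even_displayExponent p) hid _).mpr
      (h hF p hp h9 h3 A B hB hA hV qB qA hqB hqA (CyclotomicField 3 ℚ) ω hω h2K P hP hgen Y hid)

/-! ## §3 The LIVE cruxes BY NAME in Hu–Shu–Yin point currency (print-only inputs) -/

/-- **19892 `LowerOffV0HSY` ⟺ (lowP-off), granted Hu–Shu–Yin's printed display** (§2 composed with
k7t-c3's `SylvesterTwoLowerSplit.lowerOffV0_iff_pairBound`, p471972). The crux of record IS «Hu–Shu–Yin's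
Heegner point of an off-`𝒱₀` pair is not `2`-divisible beyond `2^{(s_B + s_A − i)/2}`». Nothing asserted.
[cite: HuShuYin2019, display (bsd) p. 12 with Cor. 4.4] [cite: BurungaleFlach2024, Thm. 1.1 and Cor. 2]
[cite: Miller2011LMS, Def. 1.1] -/
theorem lowerOffV0HSY_iff_pointBoundOffV0 (hH : shaAnPair_mul_height_eq_two_zpow_mul_height) :
    Theses.SylvesterTwoHeegnerIndex.LowerOffV0HSY ↔
      (Theses.SylvesterTwoHeegnerIndex.PublishedFactsTwo → ∀ (p : ℕ), p.Prime → (p % 9 = 4 ∨ p % 9 = 7) →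
        (¬ ∃ x : ZMod p, x ^ 3 = 3) →
        ∀ (A B : WeierstrassCurve ℚ) [A.IsElliptic] [A.IsGloballyMinimal] [B.IsElliptic]
          [B.IsGloballyMinimal], (∃ C : VariableChange ℚ, C • B = cubeSumCurve (p : ℚ)) →
          (∃ C : VariableChange ℚ, C • A = cubeSumCurve (3 * (p : ℚ) ^ 2)) →
          ¬ (Nat.card (AddCommGroup.primaryComponent B.sha 2) = 1 ∧
            Nat.card (AddCommGroup.primaryComponent A.sha 2) = 1) →
          ∀ (qB qA : ℚ), shaAn B = (qB : ℂ) → shaAn A = (qA : ℂ) →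
          ∀ (K : Type) [Field K] [NumberField K] (ω : K), ω ^ 2 + ω + 1 = 0 → Module.finrank ℚ K = 2 →
          ∀ (P₀ : B.toAffine.Point), ¬ IsOfFinAddOrder (QuadraticDescent.incl K B P₀) →
            (∀ Q : B.toAffine.Point, ∃ m : ℤ,
              IsOfFinAddOrder (QuadraticDescent.incl K B Q - m • QuadraticDescent.incl K B P₀)) →
          ∀ (Y : (B.baseChange K).toAffine.Point),
            ((qB * qA : ℚ) : ℝ) * canonicalHeight (QuadraticDescent.incl K B P₀) =
              (2 : ℝ) ^ (if p % 9 = 4 then (0 : ℤ) else -2) * canonicalHeight Y →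
          ∀ j : ℕ, (∃ Y' T' : (B.baseChange K).toAffine.Point,
              IsOfFinAddOrder T' ∧ Y = ((2 : ℤ) ^ j) • Y' + T') →
            (if p % 9 = 4 then (0 : ℤ) else -2) + 2 * (j : ℤ) ≤
              (padicValNat 2 (Nat.card (AddCommGroup.primaryComponent B.sha 2)) : ℤ) +
                (padicValNat 2 (Nat.card (AddCommGroup.primaryComponent A.sha 2)) : ℤ)) :=
  SylvesterTwoLowerSplit.lowerOffV0_iff_pairBound.trans (pairBoundOffV0_iff_pointBoundOffV0 hH)

/-- **19891 `LowerOnV0HSY` ⟺ (lowP-on), granted Hu–Shu–Yin's printed display** (§2 composed with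
`SylvesterTwoLowerSplit.lowerOnV0_iff_pairLeZero`, p471972): the `𝒱₀` crux of record IS «where both
`2`-primary Ш's are trivial, Hu–Shu–Yin's Heegner point is `2`-primitive (`p ≡ 4 (9)`) / not in
`4·E_p(K) + tors` (`p ≡ 7 (9)`)». Nothing asserted. [cite: HuShuYin2019, display (bsd) p. 12 with Cor. 4.4]
[cite: BurungaleFlach2024, Thm. 1.1 and Cor. 2] [cite: Miller2011LMS, Def. 1.1] -/
theorem lowerOnV0HSY_iff_pointBoundOnV0 (hH : shaAnPair_mul_height_eq_two_zpow_mul_height) :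
    Theses.SylvesterTwoHeegnerIndex.LowerOnV0HSY ↔
      (Theses.SylvesterTwoHeegnerIndex.PublishedFactsTwo → ∀ (p : ℕ), p.Prime → (p % 9 = 4 ∨ p % 9 = 7) →
        (¬ ∃ x : ZMod p, x ^ 3 = 3) →
        ∀ (A B : WeierstrassCurve ℚ) [A.IsElliptic] [A.IsGloballyMinimal] [B.IsElliptic]
          [B.IsGloballyMinimal], (∃ C : VariableChange ℚ, C • B = cubeSumCurve (p : ℚ)) →
          (∃ C : VariableChange ℚ, C • A = cubeSumCurve (3 * (p : ℚ) ^ 2)) →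
          (Nat.card (AddCommGroup.primaryComponent B.sha 2) = 1 ∧
            Nat.card (AddCommGroup.primaryComponent A.sha 2) = 1) →
          ∀ (qB qA : ℚ), shaAn B = (qB : ℂ) → shaAn A = (qA : ℂ) →
          ∀ (K : Type) [Field K] [NumberField K] (ω : K), ω ^ 2 + ω + 1 = 0 → Module.finrank ℚ K = 2 →
          ∀ (P₀ : B.toAffine.Point), ¬ IsOfFinAddOrder (QuadraticDescent.incl K B P₀) →
            (∀ Q : B.toAffine.Point, ∃ m : ℤ,
              IsOfFinAddOrder (QuadraticDescent.incl K B Q - m • QuadraticDescent.incl K B P₀)) →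
          ∀ (Y : (B.baseChange K).toAffine.Point),
            ((qB * qA : ℚ) : ℝ) * canonicalHeight (QuadraticDescent.incl K B P₀) =
              (2 : ℝ) ^ (if p % 9 = 4 then (0 : ℤ) else -2) * canonicalHeight Y →
          ∀ j : ℕ, (∃ Y' T' : (B.baseChange K).toAffine.Point,
              IsOfFinAddOrder T' ∧ Y = ((2 : ℤ) ^ j) • Y' + T') →
            (if p % 9 = 4 then (0 : ℤ) else -2) + 2 * (j : ℤ) ≤ 0) :=
  SylvesterTwoLowerSplit.lowerOnV0_iff_pairLeZero.trans (pairLeZeroOnV0_iff_pointBoundOnV0 hH)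

end Summit.BirchSwinnertonDyer.BirchSwinnertonDyer.Theorems.SylvesterTwoYinLower

end
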